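import Summits.Ventures.Crystal3D.Theorems.StickyWulffConstantCoaxialWallLawOnSiteTools
import Summits.Ventures.Crystal3D.Theorems.StickyWulffConstantGenericWallFloorStarLemma
import Summits.Ventures.Crystal3D.Theorems.StickyWulffConstantCoaxialWallLawEndRowIntModel
import HarnessLib

/-!
# Heights on a Barlow window: the neighbour menu, the model normals, same-layer purity
# (crux `CoaxialWallLaw`, stmt-Ventures-19481, line `WallLedgerF`; lattice bricks for the far-slot discharge)

HONEST FRAMING. Venture `Summits/Ventures/Crystal3D` (cell `crystal3d-full`), helper `--supports` the crux
`CoaxialWallLaw` (stmt-Ventures-19481, `route-Ventures-StickyWulffConstant`), REGISTERED line `WallLedgerF` (planner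
cf-p1).  Rung credit; F-C1 not moved; census-free lattice facts used by `…BarlowWindowTwinReadings` (discharge of the
outer-shell lemma's far-slot hypothesis, cf-p1 (xlviii)).

* `neighbourMenu_apply_two` — vectors of `D₊ ∪ D₋` (`fccSlots ∪ basalMirror '' fccSlots`) have height `0` or `±√(2/3)`;
  `not_mem_fccSlots_of_offPlane_image` — an off-plane vector of `D₋` is not in `D₊`;
* `face_heights` (kernel `decide` over the slot table: the height indices of a `60°` slot triangle
  sum to `±1` or `±3`), **`modelNormal_apply_two`** — a model `{111}` normal has height `±1` or `±1/3`;
* `neighbour_up_mem` / `neighbour_down_mem` — a site one layer above / below a site at distance `1` differs from it by a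
  `D₊` vector if the step letter is `+1` and by an off-plane `D₋` vector (not in `D₊`) if it is `−1`;
  **`sameLayer_purity`** — two such sites at the same nonzero height are both `D₊`-neighbours or both not.
WHAT THIS IS NOT: not the far-slot theorem (next file); F-C1 not moved.
-/

noncomputable section

namespace Summit.Ventures.Crystal3D.Theorems

open Summit.Ventures.Crystal3D Finset NearIdentity
open Literature.MathematicalPhysics.StatisticalMechanics (barlowPos barlowStacking fccStacking constHagg IsHaggSeq
  haggLabel haggLabel_succ basalMirror basalMirror_apply_coord basalMirror_basalMirror barlowPos_apply_two
  dist_barlowPos_eq_iff)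
open scoped InnerProductSpace

/-! ### Heights -/

/-- Vectors of the neighbour menu `D₊ ∪ D₋` have height `0`, `√(2/3)` or `−√(2/3)`. -/
theorem neighbourMenu_apply_two {y : EuclideanSpace ℝ (Fin 3)}
    (hy : y ∈ fccSlots ∨ y ∈ (basalMirror : EuclideanSpace ℝ (Fin 3) → EuclideanSpace ℝ (Fin 3)) '' ↑fccSlots) :
    y 2 = 0 ∨ y 2 = Real.sqrt (2 / 3) ∨ y 2 = -Real.sqrt (2 / 3) := by
  rcases hy with hy | ⟨w, hw, rfl⟩
  · exact slot_apply_two_cases hy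
  · rw [basalMirror_apply_coord]
    simp only [if_true]
    rcases slot_apply_two_cases (mem_coe.1 hw) with h | h | h
    · exact Or.inl (by rw [h, neg_zero])
    · exact Or.inr (Or.inr (by rw [h]))
    · exact Or.inr (Or.inl (by rw [h, neg_neg]))

/-- An OFF-PLANE vector of `D₋` is not a slot of `D₊`. -/
theorem not_mem_fccSlots_of_offPlane_image {y : EuclideanSpace ℝ (Fin 3)}
    (hy : y ∈ (basalMirror : EuclideanSpace ℝ (Fin 3) → EuclideanSpace ℝ (Fin 3)) '' ↑fccSlots) (hy2 : y 2 ≠ 0) :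
    y ∉ fccSlots := by
  obtain ⟨w, hw, rfl⟩ := hy
  intro hM
  have hw' := mem_coe.1 hw
  have h := inner_slots_mem hw' hM
  rw [inner_basalMirror_right, real_inner_self_eq_norm_sq, norm_eq_one_of_mem_fccSlots hw'] at h
  have hw2 : w 2 * w 2 = 2 / 3 := by
    have h23 : Real.sqrt (2 / 3) * Real.sqrt (2 / 3) = 2 / 3 := Real.mul_self_sqrt (by norm_num)
    have hne : w 2 ≠ 0 := by
      intro h0; apply hy2; rw [basalMirror_apply_coord]; simp [h0]
    rcases slot_apply_two_cases hw' with h0 | h0 | h0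
    · exact absurd h0 hne
    · rw [h0, h23]
    · rw [h0, neg_mul_neg, h23]
  rw [hw2] at h
  norm_num at h

/-- **Face heights** (kernel check): the height indices of a `60°` slot triangle sum to `±1` or `±3`. -/
theorem face_heights : ∀ k l m : Fin 12, slotInt k ⬝ᵥ slotInt l = 1 → slotInt k ⬝ᵥ slotInt m = 1 →
    slotInt l ⬝ᵥ slotInt m = 1 →
    ((slotKIJ k).1 + (slotKIJ l).1 + (slotKIJ m).1 = 1 ∨ (slotKIJ k).1 + (slotKIJ l).1 + (slotKIJ m).1 = -1 ∨
      (slotKIJ k).1 + (slotKIJ l).1 + (slotKIJ m).1 = 3 ∨ (slotKIJ k).1 + (slotKIJ l).1 + (slotKIJ m).1 = -3) := by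
  decide

/-- A `60°` pair of slots has integer dot product `1` in cubic coordinates. -/
theorem slotInt_dot_eq_one_of_inner {k l : Fin 12} (h : ⟪slotSite k, slotSite l⟫_ℝ = 1 / 2) :
    slotInt k ⬝ᵥ slotInt l = 1 := by
  rw [inner_slotSite] at h
  have : ((slotInt k ⬝ᵥ slotInt l : ℤ) : ℝ) = 1 := by linarith
  exact_mod_cast this

/-- **A model `{111}` normal has height `±1` or `±1/3`.** -/
theorem modelNormal_apply_two {n : EuclideanSpace ℝ (Fin 3)} (hn : n ∈ modelNormals) :
    n 2 = 1 ∨ n 2 = -1 ∨ n 2 = 1 / 3 ∨ n 2 = -(1 / 3) := by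
  classical
  rw [modelNormals, mem_image] at hn
  obtain ⟨t, ht, rfl⟩ := hn
  obtain ⟨hmem, hab, hac, hbc⟩ := mem_filter.1 ht
  obtain ⟨⟨ha, hb⟩, hc⟩ := mem_product.1 hmem |>.imp_left mem_product.1
  obtain ⟨k, hk⟩ := exists_slotSite_eq ha
  obtain ⟨l, hl⟩ := exists_slotSite_eq hb
  obtain ⟨m, hm⟩ := exists_slotSite_eq hc
  rw [← hk] at hab hac ⊢
  rw [← hl] at hab hbc ⊢
  rw [← hm] at hac hbc ⊢
  have hsum := face_heights k l m (slotInt_dot_eq_one_of_inner hab) (slotInt_dot_eq_one_of_inner hac)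
    (slotInt_dot_eq_one_of_inner hbc)
  have h6 : (Real.sqrt 6)⁻¹ * Real.sqrt (2 / 3) = 1 / 3 := by
    rw [show (2 / 3 : ℝ) = 6 / 9 by norm_num, Real.sqrt_div' _ (by norm_num), show (9 : ℝ) = 3 ^ 2 by norm_num,
      Real.sqrt_sq (by norm_num)]
    have h6' : Real.sqrt 6 ≠ 0 := by positivity
    field_simp
  have key : ((Real.sqrt 6)⁻¹ • (slotSite k + slotSite l + slotSite m)) 2 =
      ((((slotKIJ k).1 + (slotKIJ l).1 + (slotKIJ m).1 : ℤ) : ℝ)) * (1 / 3) := by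
    rw [← h6]
    simp only [PiLp.smul_apply, PiLp.add_apply, EndRowFloor.slotSite_two, smul_eq_mul]
    push_cast; ring
  rw [key]
  rcases hsum with h | h | h | h <;> rw [h] <;> norm_num

/-! ### Same-layer purity -/

/-- **Neighbours one layer UP**: for sites `q = (k,i,j)`, `x = (k+1,i',j')` at distance `1`, the step letter decides the
dozen: `s k = 1` ⇒ `x − q ∈ D₊`; `s k = −1` ⇒ `x − q ∈ D₋ ∖ D₊`. -/
theorem neighbour_up_mem {s : ℤ → ℤ} (hs : IsHaggSeq s) (k i j i' j' : ℤ)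
    (hd : dist (barlowPos 1 (Real.sqrt (2 / 3)) s k i j) (barlowPos 1 (Real.sqrt (2 / 3)) s (k + 1) i' j') = 1) :
    (s k = 1 ∧ barlowPos 1 (Real.sqrt (2 / 3)) s (k + 1) i' j' - barlowPos 1 (Real.sqrt (2 / 3)) s k i j ∈ fccSlots) ∨
    (s k = -1 ∧ barlowPos 1 (Real.sqrt (2 / 3)) s (k + 1) i' j' - barlowPos 1 (Real.sqrt (2 / 3)) s k i j ∈
        (basalMirror : EuclideanSpace ℝ (Fin 3) → EuclideanSpace ℝ (Fin 3)) '' ↑fccSlots ∧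
      barlowPos 1 (Real.sqrt (2 / 3)) s (k + 1) i' j' - barlowPos 1 (Real.sqrt (2 / 3)) s k i j ∉ fccSlots) := by
  have hh : Real.sqrt (2 / 3) ^ 2 = 2 / 3 * (1 : ℝ) ^ 2 := by rw [Real.sq_sqrt (by norm_num)]; ring
  have hr : 0 < Real.sqrt (2 / 3) := Real.sqrt_pos.2 (by norm_num)
  rcases (dist_barlowPos_eq_iff hs one_pos hh k i j (k + 1) i' j').1 hd with ⟨hk, -⟩ | ⟨-, hm⟩ | ⟨hk, -⟩
  · omega
  · rw [barlowPos_sub_barlowPos]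
    rcases hs k with h1 | h1
    · left
      refine ⟨h1, ?_⟩
      have key : ∀ PQ ∈ Literature.MathematicalPhysics.StatisticalMechanics.threeOffsets (-1),
          ((1 : ℤ), -PQ.1, -PQ.2) ∈ fccSlotTriples := by decide
      rw [h1] at hm
      have hmem := barlowPos_mem_fccSlots (key _ hm)
      rw [barlowPos_constHagg_eq] at hmem
      convert hmem using 1
      rw [haggLabel_succ, h1, add_sub_cancel_left, add_sub_cancel_left]; push_cast; module
    · right
      have key : ∀ PQ ∈ Literature.MathematicalPhysics.StatisticalMechanics.threeOffsets 1,
          ((-1 : ℤ), -PQ.1, -PQ.2) ∈ fccSlotTriples := by decide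
      rw [h1, neg_neg] at hm
      have hmem : ((i' - i : ℤ) : ℝ) • Literature.MathematicalPhysics.StatisticalMechanics.triangularVec₁ 1 +
            ((j' - j : ℤ) : ℝ) • Literature.MathematicalPhysics.StatisticalMechanics.triangularVec₂ 1 +
            ((haggLabel s (k + 1) - haggLabel s k : ℤ) : ℝ) • Literature.MathematicalPhysics.StatisticalMechanics.barlowOffset 1 +
            ((k + 1 - k : ℤ) : ℝ) • Literature.MathematicalPhysics.StatisticalMechanics.layerNormal (Real.sqrt (2 / 3)) ∈
          (basalMirror : EuclideanSpace ℝ (Fin 3) → EuclideanSpace ℝ (Fin 3)) '' ↑fccSlots := by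
        refine ⟨barlowPos 1 (Real.sqrt (2 / 3)) constHagg (-1) (-(i - i')) (-(j - j')),
          mem_coe.2 (barlowPos_mem_fccSlots (key _ hm)), ?_⟩
        rw [Literature.MathematicalPhysics.StatisticalMechanics.basalMirror_barlowPos_constHagg, haggLabel_succ, h1,
          add_sub_cancel_left, add_sub_cancel_left]
        push_cast; module
      refine ⟨h1, hmem, not_mem_fccSlots_of_offPlane_image hmem ?_⟩
      rw [← barlowPos_sub_barlowPos]
      change (barlowPos 1 (Real.sqrt (2 / 3)) s (k + 1) i' j') 2 - (barlowPos 1 (Real.sqrt (2 / 3)) s k i j) 2 ≠ 0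
      rw [barlowPos_apply_two, barlowPos_apply_two]; push_cast; nlinarith [hr]
  · omega

/-- **Neighbours one layer DOWN**: for sites `q = (k,i,j)`, `x = (k−1,i',j')` at distance `1`: `s (k−1) = 1` ⇒
`x − q ∈ D₊`; `s (k−1) = −1` ⇒ `x − q ∈ D₋ ∖ D₊`. -/
theorem neighbour_down_mem {s : ℤ → ℤ} (hs : IsHaggSeq s) (k i j i' j' : ℤ)
    (hd : dist (barlowPos 1 (Real.sqrt (2 / 3)) s k i j) (barlowPos 1 (Real.sqrt (2 / 3)) s (k - 1) i' j') = 1) :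
    (s (k - 1) = 1 ∧ barlowPos 1 (Real.sqrt (2 / 3)) s (k - 1) i' j' - barlowPos 1 (Real.sqrt (2 / 3)) s k i j ∈ fccSlots) ∨
    (s (k - 1) = -1 ∧ barlowPos 1 (Real.sqrt (2 / 3)) s (k - 1) i' j' - barlowPos 1 (Real.sqrt (2 / 3)) s k i j ∈
        (basalMirror : EuclideanSpace ℝ (Fin 3) → EuclideanSpace ℝ (Fin 3)) '' ↑fccSlots ∧
      barlowPos 1 (Real.sqrt (2 / 3)) s (k - 1) i' j' - barlowPos 1 (Real.sqrt (2 / 3)) s k i j ∉ fccSlots) := by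
  have hh : Real.sqrt (2 / 3) ^ 2 = 2 / 3 * (1 : ℝ) ^ 2 := by rw [Real.sq_sqrt (by norm_num)]; ring
  have hr : 0 < Real.sqrt (2 / 3) := Real.sqrt_pos.2 (by norm_num)
  rcases (dist_barlowPos_eq_iff hs one_pos hh k i j (k - 1) i' j').1 hd with ⟨hk, -⟩ | ⟨hk, -⟩ | ⟨-, hm⟩
  · omega
  · omega
  · rw [barlowPos_sub_barlowPos]
    rcases hs (k - 1) with h1 | h1
    · left
      refine ⟨h1, ?_⟩
      have key : ∀ PQ ∈ Literature.MathematicalPhysics.StatisticalMechanics.threeOffsets 1,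
          ((-1 : ℤ), -PQ.1, -PQ.2) ∈ fccSlotTriples := by decide
      rw [h1] at hm
      have hmem := barlowPos_mem_fccSlots (key _ hm)
      rw [barlowPos_constHagg_eq] at hmem
      have hL : haggLabel s (k - 1) - haggLabel s k = -1 := by
        have := haggLabel_succ (s := s) (k - 1); rw [sub_add_cancel, h1] at this; omega
      convert hmem using 1
      rw [hL, show k - 1 - k = -1 by ring]; push_cast; module
    · right
      have key : ∀ PQ ∈ Literature.MathematicalPhysics.StatisticalMechanics.threeOffsets (-1),
          ((1 : ℤ), -PQ.1, -PQ.2) ∈ fccSlotTriples := by decide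
      rw [h1] at hm
      have hL : haggLabel s (k - 1) - haggLabel s k = 1 := by
        have := haggLabel_succ (s := s) (k - 1); rw [sub_add_cancel, h1] at this; omega
      have hmem : ((i' - i : ℤ) : ℝ) • Literature.MathematicalPhysics.StatisticalMechanics.triangularVec₁ 1 +
            ((j' - j : ℤ) : ℝ) • Literature.MathematicalPhysics.StatisticalMechanics.triangularVec₂ 1 +
            ((haggLabel s (k - 1) - haggLabel s k : ℤ) : ℝ) • Literature.MathematicalPhysics.StatisticalMechanics.barlowOffset 1 +
            ((k - 1 - k : ℤ) : ℝ) • Literature.MathematicalPhysics.StatisticalMechanics.layerNormal (Real.sqrt (2 / 3)) ∈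
          (basalMirror : EuclideanSpace ℝ (Fin 3) → EuclideanSpace ℝ (Fin 3)) '' ↑fccSlots := by
        refine ⟨barlowPos 1 (Real.sqrt (2 / 3)) constHagg 1 (-(i - i')) (-(j - j')),
          mem_coe.2 (barlowPos_mem_fccSlots (key _ hm)), ?_⟩
        rw [Literature.MathematicalPhysics.StatisticalMechanics.basalMirror_barlowPos_constHagg, hL,
          show k - 1 - k = -1 by ring]
        push_cast; module
      refine ⟨h1, hmem, not_mem_fccSlots_of_offPlane_image hmem ?_⟩
      rw [← barlowPos_sub_barlowPos]
      change (barlowPos 1 (Real.sqrt (2 / 3)) s (k - 1) i' j') 2 - (barlowPos 1 (Real.sqrt (2 / 3)) s k i j) 2 ≠ 0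
      rw [barlowPos_apply_two, barlowPos_apply_two]; push_cast; nlinarith [hr]

/-- **Same-layer purity**: two sites at distance `1` from a site `q`, at the same nonzero height relative to `q`, differ
from `q` by vectors of the same dozen: both in `D₊` or both outside `D₊`. -/
theorem sameLayer_purity {s : ℤ → ℤ} (hs : IsHaggSeq s) {q x x' : EuclideanSpace ℝ (Fin 3)}
    (hq : q ∈ barlowStacking 1 (Real.sqrt (2 / 3)) s) (hx : x ∈ barlowStacking 1 (Real.sqrt (2 / 3)) s)
    (hx' : x' ∈ barlowStacking 1 (Real.sqrt (2 / 3)) s) (hd : dist q x = 1) (hd' : dist q x' = 1)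
    (hh : (x - q) 2 = (x' - q) 2) (hne : (x - q) 2 ≠ 0) :
    (x - q ∈ fccSlots ∧ x' - q ∈ fccSlots) ∨ (x - q ∉ fccSlots ∧ x' - q ∉ fccSlots) := by
  have hr : 0 < Real.sqrt (2 / 3) := Real.sqrt_pos.2 (by norm_num)
  have hh23 : Real.sqrt (2 / 3) ^ 2 = 2 / 3 * (1 : ℝ) ^ 2 := by rw [Real.sq_sqrt (by norm_num)]; ring
  obtain ⟨k, i, j, rfl⟩ := hq
  obtain ⟨k₁, i₁, j₁, rfl⟩ := hx
  obtain ⟨k₂, i₂, j₂, rfl⟩ := hx'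
  have e1 : (barlowPos 1 (Real.sqrt (2 / 3)) s k₁ i₁ j₁ - barlowPos 1 (Real.sqrt (2 / 3)) s k i j) 2 =
      ((k₁ - k : ℤ) : ℝ) * Real.sqrt (2 / 3) := by
    change (barlowPos 1 (Real.sqrt (2 / 3)) s k₁ i₁ j₁) 2 - (barlowPos 1 (Real.sqrt (2 / 3)) s k i j) 2 = _
    rw [barlowPos_apply_two, barlowPos_apply_two]; push_cast; ring
  have e2 : (barlowPos 1 (Real.sqrt (2 / 3)) s k₂ i₂ j₂ - barlowPos 1 (Real.sqrt (2 / 3)) s k i j) 2 =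
      ((k₂ - k : ℤ) : ℝ) * Real.sqrt (2 / 3) := by
    change (barlowPos 1 (Real.sqrt (2 / 3)) s k₂ i₂ j₂) 2 - (barlowPos 1 (Real.sqrt (2 / 3)) s k i j) 2 = _
    rw [barlowPos_apply_two, barlowPos_apply_two]; push_cast; ring
  rw [e1, e2] at hh
  rw [e1] at hne
  have hk12 : k₁ = k₂ := by
    have : ((k₁ - k : ℤ) : ℝ) = ((k₂ - k : ℤ) : ℝ) := mul_right_cancel₀ hr.ne' hh
    have := Int.cast_injective this
    omega
  subst hk12
  have hk1 : k₁ ≠ k := by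
    intro h; apply hne; rw [h, sub_self]; push_cast; ring
  -- `k₁ = k ± 1`
  rcases (dist_barlowPos_eq_iff hs one_pos hh23 k i j k₁ i₁ j₁).1 hd with ⟨hk, -⟩ | ⟨hk, -⟩ | ⟨hk, -⟩
  · exact absurd hk hk1
  · subst hk
    rcases neighbour_up_mem hs k i j i₁ j₁ hd with ⟨h1, hm1⟩ | ⟨h1, -, hm1⟩ <;>
      rcases neighbour_up_mem hs k i j i₂ j₂ hd' with ⟨h2, hm2⟩ | ⟨h2, -, hm2⟩
    · exact Or.inl ⟨hm1, hm2⟩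
    · omega
    · omega
    · exact Or.inr ⟨hm1, hm2⟩
  · subst hk
    rcases neighbour_down_mem hs k i j i₁ j₁ hd with ⟨h1, hm1⟩ | ⟨h1, -, hm1⟩ <;>
      rcases neighbour_down_mem hs k i j i₂ j₂ hd' with ⟨h2, hm2⟩ | ⟨h2, -, hm2⟩
    · exact Or.inl ⟨hm1, hm2⟩
    · omega
    · omega
    · exact Or.inr ⟨hm1, hm2⟩

end Summit.Ventures.Crystal3D.Theorems

end
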